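import Summits.MatrixMultiplication.OmegaCensus.STPPSmallPatternLawBridgeSplit
import Mathlib.GroupTheory.Exponent

/-!
# ω-census, small patterns `(2,1,1)^k` / `(1,2,2)^k`: the split 3-AP-free law — `T1` generic branch and the EXPONENT forms

HONEST FRAMING (pub-omega census; verbatim): lottery ticket; floor = certified bounds/negative ranges.
Census STRUCTURE bookkeeping for column B5 (`T1`, `T2` host laws); nothing here bears on `ω` (thin patterns never beat the packing bound).
Seat pub-omega ENG2 (gen 39), 2026-08-30, on the night lead's remark (g44, 03:35Z); a complement to stpp-3 gen 30's
`STPPSmallPatternLawBridgeSplit` (which proves the `T2` generic branches `exists_isSTPP_122pow_of_addOrderOf_split` / `…_halfSplit` by the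
same quotient argument and is imported, not restated).

What is added here, for `f : Fin k → ℕ` injective with 3-AP-free range and `fᵢ ≤ F`, `G` finite abelian:

* `T1` generic branch `exists_isSTPP_211pow_of_addOrderOf_split`: an element `g` with `addOrderOf g ≥ 2F + 1` and `|G| ≥ 2 · addOrderOf g` gives
  `(2,1,1)^k ⊆ G` (lift a nonzero element of `G ⧸ ⟨g⟩`; bounded independence by `apSplit_indep₁_of_quotient` with `B = 2F`);
* the EXPONENT forms (an element of order `exponent G` exists in a finite abelian group, `AddMonoid.exists_addOrderOf_eq_exponent`):
  `exists_isSTPP_211pow_of_exponent_split` (`e ≥ 2F + 1`, `|G| ≥ 2e`), `exists_isSTPP_122pow_of_exponent_split` (`e ≥ 2F + 1`, `|G| ≥ 4e`),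
  `exists_isSTPP_122pow_of_exponent_halfSplit` (`e ≥ 4F + 2`, `|G| ≥ 2e`);
* the NON-CYCLIC reading of `T1`: `exponent G ≥ 2F + 1` and `|G| ≠ exponent G` (i.e. `G` not cyclic; then `|G| ≥ 2e` because `e ∣ |G|`) ⇒
  `(2,1,1)^k ⊆ G` (`exists_isSTPP_211pow_of_exponent_ge_of_card_ne`).

So for `T1` a residual census type is settled by (exponent, order) alone once a 3-AP-free `f` with `2F + 1 ≤ exponent` is fixed: the only groups of
exponent `e ≥ 2F + 1` NOT covered are the cyclic ones `ℤ/e` with `e < 4F + 2` (ENG2's cyclic law `STPPSmallPatternCyclicThreeAPFree` starts there).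
No sharpness claim anywhere.  References: H. Cohn, R. Kleinberg, B. Szegedy, C. Umans, FOCS 2005 (arXiv:math/0511460), Def. 5.1.
-/

open Literature.Computability.AlgebraicComplexity Finset

namespace Summit.MatrixMultiplication.OmegaCensus

section splitcard

variable {G : Type*} [AddCommGroup G] [Finite G] [DecidableEq G]

/-- **GENERIC `T1` SPLIT BRANCH: an element `g` of order `≥ 2F + 1` with `|G| ≥ 2 · ord g` gives `(2,1,1)^k ⊆ G`.**
[cite: CohnKleinbergSzegedyUmans2005, Def. 5.1] -/
theorem exists_isSTPP_211pow_of_addOrderOf_split {k : ℕ} (f : Fin k → ℕ) (hf : Function.Injective f)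
    (hap : ThreeAPFree (Set.range f)) (F : ℕ) (hF : ∀ i, f i ≤ F) (g : G) (hg : 2 * F + 1 ≤ addOrderOf g)
    (hcard : 2 * addOrderOf g ≤ Nat.card G) :
    ∃ A B C : Fin k → Finset G, IsSTPP A B C ∧ ∀ i, (A i).card = 2 ∧ (B i).card = 1 ∧ (C i).card = 1 := by
  have hQ : 2 ≤ Nat.card (G ⧸ AddSubgroup.zmultiples g) := by
    have h := card_eq_card_quotient_zmultiples_mul g
    by_contra hlt
    have : Nat.card (G ⧸ AddSubgroup.zmultiples g) * addOrderOf g ≤ 1 * addOrderOf g := Nat.mul_le_mul_right _ (by omega)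
    omega
  obtain ⟨x, hx⟩ := exists_ne_zero_of_two_le_card hQ
  obtain ⟨κ, rfl⟩ := QuotientAddGroup.mk_surjective x
  exact exists_isSTPP_211pow_of_apSplit f hf hap F hF g κ (apSplit_indep₁_of_quotient (2 * F) g κ hg hx)

/-- **`T1` EXPONENT FORM: `exponent G ≥ 2F + 1` and `|G| ≥ 2 · exponent G` ⇒ `(2,1,1)^k ⊆ G`.** [cite: CohnKleinbergSzegedyUmans2005, Def. 5.1] -/
theorem exists_isSTPP_211pow_of_exponent_split {k : ℕ} (f : Fin k → ℕ) (hf : Function.Injective f)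
    (hap : ThreeAPFree (Set.range f)) (F : ℕ) (hF : ∀ i, f i ≤ F) (he : 2 * F + 1 ≤ AddMonoid.exponent G)
    (hcard : 2 * AddMonoid.exponent G ≤ Nat.card G) :
    ∃ A B C : Fin k → Finset G, IsSTPP A B C ∧ ∀ i, (A i).card = 2 ∧ (B i).card = 1 ∧ (C i).card = 1 := by
  obtain ⟨g, hg⟩ := AddMonoid.exists_addOrderOf_eq_exponent (G := G) AddMonoid.ExponentExists.of_finite
  exact exists_isSTPP_211pow_of_addOrderOf_split f hf hap F hF g (by rw [hg]; exact he) (by rw [hg]; exact hcard)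

/-- **`T1`, NON-CYCLIC READING: `exponent G ≥ 2F + 1` and `|G| ≠ exponent G` ⇒ `(2,1,1)^k ⊆ G`** (the exponent divides the order, so a finite
abelian group whose order is not its exponent has `|G| ≥ 2 · exponent G`). [cite: CohnKleinbergSzegedyUmans2005, Def. 5.1] -/
theorem exists_isSTPP_211pow_of_exponent_ge_of_card_ne {k : ℕ} (f : Fin k → ℕ) (hf : Function.Injective f)
    (hap : ThreeAPFree (Set.range f)) (F : ℕ) (hF : ∀ i, f i ≤ F) (he : 2 * F + 1 ≤ AddMonoid.exponent G)
    (hne : Nat.card G ≠ AddMonoid.exponent G) :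
    ∃ A B C : Fin k → Finset G, IsSTPP A B C ∧ ∀ i, (A i).card = 2 ∧ (B i).card = 1 ∧ (C i).card = 1 := by
  obtain ⟨m, hm⟩ := AddGroup.exponent_dvd_nat_card (G := G)
  have hpos : 0 < Nat.card G := Nat.card_pos
  have hm2 : 2 ≤ m := by
    rcases Nat.lt_or_ge m 2 with h | h
    · interval_cases m
      · rw [hm, mul_zero] at hpos; exact absurd hpos (lt_irrefl 0)
      · rw [mul_one] at hm; exact absurd hm hne
    · exact h
  have hcard : 2 * AddMonoid.exponent G ≤ Nat.card G := by
    rw [hm, mul_comm]; exact Nat.mul_le_mul_left _ hm2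
  exact exists_isSTPP_211pow_of_exponent_split f hf hap F hF he hcard

/-- **`T2` EXPONENT FORM (split branch): `exponent G ≥ 2F + 1` and `|G| ≥ 4 · exponent G` ⇒ `(1,2,2)^k ⊆ G`** (via stpp-3's
`exists_isSTPP_122pow_of_addOrderOf_split`). [cite: CohnKleinbergSzegedyUmans2005, Def. 5.1] -/
theorem exists_isSTPP_122pow_of_exponent_split {k : ℕ} (f : Fin k → ℕ) (hf : Function.Injective f)
    (hap : ThreeAPFree (Set.range f)) (F : ℕ) (hF : ∀ i, f i ≤ F) (he : 2 * F + 1 ≤ AddMonoid.exponent G)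
    (hcard : 4 * AddMonoid.exponent G ≤ Nat.card G) :
    ∃ A B C : Fin k → Finset G, IsSTPP A B C ∧ ∀ i, (A i).card = 1 ∧ (B i).card = 2 ∧ (C i).card = 2 := by
  obtain ⟨g, hg⟩ := AddMonoid.exists_addOrderOf_eq_exponent (G := G) AddMonoid.ExponentExists.of_finite
  exact exists_isSTPP_122pow_of_addOrderOf_split f hf hap F hF g (by rw [hg]; exact he) (by rw [hg]; exact hcard)

/-- **`T2` EXPONENT FORM (half-split branch): `exponent G ≥ 4F + 2` and `|G| ≥ 2 · exponent G` ⇒ `(1,2,2)^k ⊆ G`** (via stpp-3's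
`exists_isSTPP_122pow_of_addOrderOf_halfSplit`). [cite: CohnKleinbergSzegedyUmans2005, Def. 5.1] -/
theorem exists_isSTPP_122pow_of_exponent_halfSplit {k : ℕ} (f : Fin k → ℕ) (hf : Function.Injective f)
    (hap : ThreeAPFree (Set.range f)) (F : ℕ) (hF : ∀ i, f i ≤ F) (he : 4 * F + 2 ≤ AddMonoid.exponent G)
    (hcard : 2 * AddMonoid.exponent G ≤ Nat.card G) :
    ∃ A B C : Fin k → Finset G, IsSTPP A B C ∧ ∀ i, (A i).card = 1 ∧ (B i).card = 2 ∧ (C i).card = 2 := by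
  obtain ⟨g, hg⟩ := AddMonoid.exists_addOrderOf_eq_exponent (G := G) AddMonoid.ExponentExists.of_finite
  exact exists_isSTPP_122pow_of_addOrderOf_halfSplit f hf hap F hF g (by rw [hg]; exact he) (by rw [hg]; exact hcard)

/-- **`T2`, NON-CYCLIC READING of the half-split branch: `exponent G ≥ 4F + 2` and `|G| ≠ exponent G` ⇒ `(1,2,2)^k ⊆ G`.**
[cite: CohnKleinbergSzegedyUmans2005, Def. 5.1] -/
theorem exists_isSTPP_122pow_of_exponent_ge_of_card_ne {k : ℕ} (f : Fin k → ℕ) (hf : Function.Injective f)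
    (hap : ThreeAPFree (Set.range f)) (F : ℕ) (hF : ∀ i, f i ≤ F) (he : 4 * F + 2 ≤ AddMonoid.exponent G)
    (hne : Nat.card G ≠ AddMonoid.exponent G) :
    ∃ A B C : Fin k → Finset G, IsSTPP A B C ∧ ∀ i, (A i).card = 1 ∧ (B i).card = 2 ∧ (C i).card = 2 := by
  obtain ⟨m, hm⟩ := AddGroup.exponent_dvd_nat_card (G := G)
  have hpos : 0 < Nat.card G := Nat.card_pos
  have hm2 : 2 ≤ m := by
    rcases Nat.lt_or_ge m 2 with h | h
    · interval_cases m
      · rw [hm, mul_zero] at hpos; exact absurd hpos (lt_irrefl 0)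
      · rw [mul_one] at hm; exact absurd hm hne
    · exact h
  have hcard : 2 * AddMonoid.exponent G ≤ Nat.card G := by
    rw [hm, mul_comm]; exact Nat.mul_le_mul_left _ hm2
  exact exists_isSTPP_122pow_of_exponent_halfSplit f hf hap F hF he hcard

end splitcard

end Summit.MatrixMultiplication.OmegaCensus
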